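import Mathlib

/-!
# A proper linear subspace exhausted by closed sets is meagre (first category)

CITATION HEADER (lean-in-tree rule 2026-08-18; pub-arnold near-miss cell, typer g17, LEMMAS §3.X AF10 (N2)(e)/(N6),
row C49, DIVERGENCE D53, CITED-FACTS F41–F43). Everything in this file is point-set topology from Mathlib,
label [folklore]; it formalises NO object of the manuscript under audit.

THE APPLICATION IT CERTIFIES (on paper, LEMMAS §3.X AF10 (N2)). Cheng–Xue, arXiv:1503.04153v5
(`n-diffusion05082019.tex`, text sent to print = Sci. China Math. 66 (2023)) state their main theorem (l.215) for a
"cusp-residual set 𝔠_{ε_0} ⊂ C^r(𝕋^n×B) with 7 ≤ r ≤ ∞", the balls 𝔅_a being defined at l.205 by an (undefined)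
norm ‖·‖_{C^r}, while the proof (l.601–612, l.653 "In the following, we assume that |P|_{C^r} ≤ 1") runs in the
Fourier-weighted norm |f|_{C^r} := sup_y Σ_{k∈ℤ^n} Σ_{|α|+|β|≤r} |∂^α_y f^k(y)| (|k^β|+1) — these sentences are
CLAIMS UNDER ADJUDICATION, quoted, never cited as facts. For finite r the space A^r := {|f|_{C^r} < ∞} is a
proper (Katznelson, *An Introduction to Harmonic Analysis*, 3rd ed., I.6.2 p.34 "Not every continuous function on
𝕋 has an absolutely convergent Fourier series"; II.2.1 p.72) dense linear subspace of the standard C^r space, and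
|·|_{C^r} is lower semicontinuous for the standard C^r topology (Fatou), so A^r = ⋃_N {|f|_{C^r} ≤ N} is a
countable union of closed sets. The theorems below then say: A^r is MEAGRE in the standard C^r space, and so is
every subset of it — in particular any set that is residual / open-dense / cusp-residual relative to A^r. (The
embedding the other way, C^{r+[n/2]+1} ⊂ A^r, is Grafakos, *Classical Fourier Analysis* 3rd ed., Thm 3.3.16
p.201 — the n-dimensional Bernstein theorem; not used here.)

MAIN RESULTS (over any nontrivially normed field 𝕜 and topological 𝕜-module E with continuous operations):
* `interior_eq_empty_of_subset_submodule` — a subset of a proper submodule has empty interior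
  (Mathlib `Submodule.eq_top_of_nonempty_interior'`);
* `isNowhereDense_of_isClosed_subset_submodule` — a closed such subset is nowhere dense;
* `isMeagre_of_eq_iUnion_isClosed` — a proper submodule that is a countable union of closed sets is meagre;
* `isMeagre_of_lowerSemicontinuous` — sublevel form: `p = {Φ < ⊤}` for a lower semicontinuous
  `Φ : E → ℝ≥0∞` and `p ≠ ⊤` ⇒ `p` meagre (the shape of the application: Φ = |·|_{C^r});
* `isMeagre_of_subset_submodule` — hence every subset of such a `p` is meagre in `E`.
-/

open Set Topology

namespace Literature.Topology.MeagreSubmodule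

variable {𝕜 E : Type*} [NontriviallyNormedField 𝕜] [AddCommGroup E] [Module 𝕜 E]
  [TopologicalSpace E] [ContinuousAdd E] [ContinuousSMul 𝕜 E]

/-- A subset of a proper submodule has empty interior. [folklore] -/
theorem interior_eq_empty_of_subset_submodule {p : Submodule 𝕜 E} (hp : p ≠ ⊤) {S : Set E}
    (hS : S ⊆ p) : interior S = ∅ := by
  by_contra h
  exact hp (p.eq_top_of_nonempty_interior' ((nonempty_iff_ne_empty.mpr h).mono (interior_mono hS)))

/-- A closed subset of a proper submodule is nowhere dense. [folklore] -/
theorem isNowhereDense_of_isClosed_subset_submodule {p : Submodule 𝕜 E} (hp : p ≠ ⊤) {S : Set E}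
    (hc : IsClosed S) (hS : S ⊆ p) : IsNowhereDense S :=
  hc.isNowhereDense_iff.mpr (interior_eq_empty_of_subset_submodule hp hS)

/-- A proper submodule which is a countable union of sets closed in the ambient space is meagre
(of first category). [folklore] -/
theorem isMeagre_of_eq_iUnion_isClosed {p : Submodule 𝕜 E} (hp : p ≠ ⊤) (S : ℕ → Set E)
    (hc : ∀ N, IsClosed (S N)) (hU : (p : Set E) = ⋃ N, S N) : IsMeagre (p : Set E) := by
  have hsub : ∀ N, S N ⊆ (p : Set E) := fun N => hU ▸ subset_iUnion S N
  rw [hU]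
  exact isMeagre_iUnion fun N =>
    (isNowhereDense_of_isClosed_subset_submodule hp (hc N) (hsub N)).isMeagre

/-- Sublevel form. If `Φ : E → ℝ≥0∞` is lower semicontinuous and the proper submodule `p` is exactly the
finiteness domain `{x | Φ x < ⊤}`, then `p` is meagre: `p = ⋃_N {Φ ≤ N}` with closed sublevel sets. This is the
shape of the application (`Φ` = a Fourier-weighted `C^r` functional on the standard `C^r` space, lower
semicontinuous by Fatou's lemma for series). [folklore] -/
theorem isMeagre_of_lowerSemicontinuous {p : Submodule 𝕜 E} (hp : p ≠ ⊤) (Φ : E → ENNReal)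
    (hΦ : LowerSemicontinuous Φ) (hpΦ : (p : Set E) = {x | Φ x < ⊤}) : IsMeagre (p : Set E) := by
  refine isMeagre_of_eq_iUnion_isClosed hp (fun N : ℕ => Φ ⁻¹' Iic (N : ENNReal))
    (fun N => lowerSemicontinuous_iff_isClosed_preimage.mp hΦ _) ?_
  rw [hpΦ]
  ext x
  simp only [mem_setOf_eq, mem_iUnion, mem_preimage, mem_Iic]
  constructor
  · intro hx
    obtain ⟨N, hN⟩ := ENNReal.exists_nat_gt hx.ne
    exact ⟨N, hN.le⟩
  · rintro ⟨N, hN⟩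
    exact lt_of_le_of_lt hN (ENNReal.natCast_lt_top N)

/-- Consequently every subset of such a submodule — e.g. a set that is residual, open-dense or
"cusp-residual" *relative to the subspace* — is meagre in the ambient space. [folklore] -/
theorem isMeagre_of_subset_submodule {p : Submodule 𝕜 E} (hp : p ≠ ⊤) (S : ℕ → Set E)
    (hc : ∀ N, IsClosed (S N)) (hU : (p : Set E) = ⋃ N, S N) {T : Set E} (hT : T ⊆ p) :
    IsMeagre T :=
  (isMeagre_of_eq_iUnion_isClosed hp S hc hU).mono hT

end Literature.Topology.MeagreSubmodule
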